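import Summits.AnomalousDissipation.AnomalousDissipation.Theses.TameRoughRigidity
import Summits.AnomalousDissipation.AnomalousDissipation.Theorems.GPStatisticalRigidity.Negative.LoadBearing
import Summits.AnomalousDissipation.AnomalousDissipation.Theorems.EnsembleRigidityResidualTransferSSSTestEnstrophyTame
import Literature.Analysis.FluidPDE.CylindricalGenerator
import Literature.Analysis.FluidPDE.EnergyToolkit
import Literature.Analysis.FunctionSpaces.TorusTestFunction
import Literature.Analysis.FunctionSpaces.TorusConvectionLaplacianNormSq
import HarnessLib

/-! # Stub stub_oddWeightedBudget of line Sketch (crux stmt-AnomalousDissipation-18401, TameRoughRigidity.TameToRough)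

**The odd-weighted budget inequality.** For a smooth force `f`, a probability measure `μ` on the
energy space `H = L²_σ(T³)` with cylindrical forced-Euler defect constant `R ≥ 0`
(`DefectLE f μ R`), a cylindrical test functional `Φ(u) = φ((u,g₁),…,(u,gₘ))` with `|φ| ≤ K`
and a compactly supported `C¹` weight `ψ` of the same coordinates with `|ψ| ≤ 1`, the PRODUCT
test functional `u ↦ ψ(coords u) Φ(u)` (profile `ψ·φ`, same fields) is again cylindrical, with
differential `ψ(coords u) Φ'(u) + Φ(u) Ψ'(u)`, `Ψ'(u) = ∑ᵢ ∂ᵢψ(coords u) gᵢ` (Leibniz rule).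
Linearity of the tested generator `w ↦ ⟨F₀(u), w⟩` in the smooth test field
(`Torus.nsGeneratorPairing_sum_smul`, Foias–Manley–Rosa–Temam 2001, Ch. IV §1.2) identifies the
odd-weighted budget `∫ (ψ ⟨F₀,Φ'⟩ + Φ ⟨F₀,Ψ'⟩) dμ` with the plain budget of the product test, the
defect clause bounds it by `R ‖∇(ψΦ' + ΦΨ')‖_{L²(μ;L²)}`, and two Minkowski inequalities (in
`L²(T³)`, via the Gram expansion `gradNormSq_sum_smul_eq_gram` and the discriminant of the
non-negative quadratic form `(s,t) ↦ ‖∇(sΦ' + tΨ')‖²`; then in `L²(μ)`, via Cauchy–Schwarz) give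

  `|∫ (ψ ⟨F₀,Φ'⟩ + Φ ⟨F₀,Ψ'⟩) dμ| ≤ R (‖∇Φ'‖_{L²(μ;L²)} + K ‖∇Ψ'‖_{L²(μ;L²)})`.

The `μ`-integrability of the test enstrophies `u ↦ ‖∇Φ'(u)‖²`, `u ↦ ‖∇Ψ'(u)‖²` (continuous and
bounded on `H`) is `ResidualTransferSSS.stub_testEnstrophyTame`.

## Mathlib / tree search

Used from the tree: `Torus.nsGeneratorPairing_sum_smul`, `Torus.nsGeneratorPairing_grad`
(`CylindricalGenerator`), `ResidualTransferSSS.gradNormSq_sum_smul_eq_gram`,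
`ResidualTransferSSS.stub_testEnstrophyTame` (`EnsembleRigidityResidualTransferSSSTestEnstrophyTame`),
`Torus.gradNormSq_nonneg` (`TorusFluidGlue`), `integral_mul_le_sqrt_mul_sqrt_of_memLp`
(`EnergyToolkit`, Cauchy–Schwarz in `L²(μ)`); from Mathlib `fderiv_fun_mul` (Leibniz),
`discrim_le_zero`, `integral_mono_of_nonneg`, `MemLp.integrable_mul`. Searched `sqrt_gradNormSq`,
`gradNormSq_add`: the tree has the quadratic `Torus.gradNormSq_add_le` and the unweighted
`stub_trainBudget_aux_sqrt_gradNormSq_le` (`BaireTransferDenseLoudDesignerForcesStubTrainBudget`);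
the weighted form for finite combinations of fixed fields (`oddWeightedBudget_sqrt_gradNormSq_le`)
is proved here from the Gram expansion.

## References

* C. Foias, O. Manley, R. Rosa, R. Temam, *Navier–Stokes Equations and Turbulence*, CUP (2001),
  Ch. IV §1.2, Def. 1.2 and the display after (1.27) (`Φ'(u) = ∑ⱼ ∂ⱼψ gⱼ`). [FoiasManleyRosaTemam2001]
-/

-- `Summit.<Summit>.<Problem>` is the tree's mandated summit-side namespace (CONVENTIONS §2); single-conjunct summit, duplicate deliberate.
set_option linter.dupNamespace false

noncomputable section

namespace Summit.AnomalousDissipation.AnomalousDissipation.Theorems.TameRoughRigidity.TameToRough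

open MeasureTheory Filter Topology UnitAddTorus
open scoped InnerProductSpace RealInnerProductSpace ENNReal NNReal
open Literature.Analysis.FunctionSpaces Literature.Analysis.FluidPDE
open Summit.AnomalousDissipation.AnomalousDissipation.Theses.TameRoughRigidity
open Summit.AnomalousDissipation.AnomalousDissipation.Theorems.GPStatisticalRigidity.Negative

/-- Local notation: real vector fields on `T³`. -/
local notation "Vec3" => (UnitAddTorus (Fin 3)) → (EuclideanSpace ℝ (Fin 3))
/-- Local notation: `L²(T³; ℝ³)`. -/
local notation "L2" => (Lp (EuclideanSpace ℝ (Fin 3)) 2 (volume : Measure (UnitAddTorus (Fin 3))))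
/-- Local notation: the energy space `H`. -/
local notation "H3" => (Torus.energySpace (Fin 3))

/-! ### Minkowski for a non-negative binary quadratic form -/

/-- **Minkowski for a non-negative binary quadratic form.** If `s²X + stZ + t²Y ≥ 0` for all real
`s, t`, then `√(s²X + stZ + t²Y) ≤ |s|√X + |t|√Y` (the discriminant bound `Z² ≤ 4XY`). [folklore] -/
theorem oddWeightedBudget_sqrt_quad_le {X Y Z : ℝ}
    (h : ∀ s t : ℝ, 0 ≤ s ^ 2 * X + s * t * Z + t ^ 2 * Y) (s t : ℝ) :
    Real.sqrt (s ^ 2 * X + s * t * Z + t ^ 2 * Y) ≤ |s| * Real.sqrt X + |t| * Real.sqrt Y := by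
  have hX : 0 ≤ X := by simpa using h 1 0
  have hY : 0 ≤ Y := by simpa using h 0 1
  have hZ2 : Z ^ 2 ≤ 4 * X * Y := by
    have hd := discrim_le_zero (K := ℝ) (a := X) (b := Z) (c := Y) fun x => by nlinarith [h x 1]
    rw [discrim] at hd
    linarith
  have hZ : |Z| ≤ 2 * (Real.sqrt X * Real.sqrt Y) := by
    have h2 : Z ^ 2 ≤ (2 * (Real.sqrt X * Real.sqrt Y)) ^ 2 := by
      have e : (2 * (Real.sqrt X * Real.sqrt Y)) ^ 2 = 4 * X * Y := by
        rw [mul_pow, mul_pow, Real.sq_sqrt hX, Real.sq_sqrt hY]; ring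
      rw [e]; exact hZ2
    have h3 := sq_le_sq.1 h2
    rwa [abs_of_nonneg (by positivity : (0 : ℝ) ≤ 2 * (Real.sqrt X * Real.sqrt Y))] at h3
  have hcross : s * t * Z ≤ |s| * |t| * (2 * (Real.sqrt X * Real.sqrt Y)) :=
    calc s * t * Z ≤ |s * t * Z| := le_abs_self _
      _ = |s| * |t| * |Z| := by rw [abs_mul, abs_mul]
      _ ≤ |s| * |t| * (2 * (Real.sqrt X * Real.sqrt Y)) :=
          mul_le_mul_of_nonneg_left hZ (by positivity)
  have hle : s ^ 2 * X + s * t * Z + t ^ 2 * Y ≤ (|s| * Real.sqrt X + |t| * Real.sqrt Y) ^ 2 := by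
    have e : (|s| * Real.sqrt X + |t| * Real.sqrt Y) ^ 2 =
        s ^ 2 * X + |s| * |t| * (2 * (Real.sqrt X * Real.sqrt Y)) + t ^ 2 * Y := by
      have h1 : |s| ^ 2 = s ^ 2 := sq_abs s
      have h2 : |t| ^ 2 = t ^ 2 := sq_abs t
      have h3 : Real.sqrt X ^ 2 = X := Real.sq_sqrt hX
      have h4 : Real.sqrt Y ^ 2 = Y := Real.sq_sqrt hY
      calc (|s| * Real.sqrt X + |t| * Real.sqrt Y) ^ 2
          = |s| ^ 2 * Real.sqrt X ^ 2 + |s| * |t| * (2 * (Real.sqrt X * Real.sqrt Y)) +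
              |t| ^ 2 * Real.sqrt Y ^ 2 := by ring
        _ = _ := by rw [h1, h2, h3, h4]
    rw [e]
    linarith [hcross]
  calc Real.sqrt (s ^ 2 * X + s * t * Z + t ^ 2 * Y)
      ≤ Real.sqrt ((|s| * Real.sqrt X + |t| * Real.sqrt Y) ^ 2) := Real.sqrt_le_sqrt hle
    _ = |s| * Real.sqrt X + |t| * Real.sqrt Y := Real.sqrt_sq (by positivity)

/-! ### Minkowski in `L²(T^d)` for the gradients of finite combinations of smooth fields -/

/-- **Minkowski for test enstrophies.** For smooth fields `gᵢ` and coefficient vectors `a, b`,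
`‖∇(∑ᵢ (s aᵢ + t bᵢ) gᵢ)‖₂ ≤ |s| ‖∇(∑ᵢ aᵢ gᵢ)‖₂ + |t| ‖∇(∑ᵢ bᵢ gᵢ)‖₂`: by the Gram expansion
`gradNormSq_sum_smul_eq_gram` the map `(s,t) ↦ ‖∇(∑ᵢ (s aᵢ + t bᵢ) gᵢ)‖₂²` is a non-negative
binary quadratic form. [folklore] -/
theorem oddWeightedBudget_sqrt_gradNormSq_le {d : Type*} [Fintype d] [DecidableEq d]
    {ι : Type*} [Fintype ι] {g : ι → UnitAddTorus d → EuclideanSpace ℝ d}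
    (hg : ∀ i, Torus.IsSmooth (g i)) (a b : ι → ℝ) (s t : ℝ) :
    Real.sqrt (Torus.gradNormSq (fun x => ∑ i, (s * a i + t * b i) • g i x)) ≤
      |s| * Real.sqrt (Torus.gradNormSq (fun x => ∑ i, a i • g i x)) +
        |t| * Real.sqrt (Torus.gradNormSq (fun x => ∑ i, b i • g i x)) := by
  obtain ⟨Z, key⟩ : ∃ Z : ℝ, ∀ s t : ℝ,
      Torus.gradNormSq (fun x => ∑ i, (s * a i + t * b i) • g i x) =
        s ^ 2 * Torus.gradNormSq (fun x => ∑ i, a i • g i x) + s * t * Z +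
          t ^ 2 * Torus.gradNormSq (fun x => ∑ i, b i • g i x) := by
    refine ⟨(∑ i, ∑ i', a i * b i' *
        ∫ y, ∑ j, ⟪Torus.partialDeriv j (g i) y, Torus.partialDeriv j (g i') y⟫_ℝ) +
        ∑ i, ∑ i', b i * a i' *
          ∫ y, ∑ j, ⟪Torus.partialDeriv j (g i) y, Torus.partialDeriv j (g i') y⟫_ℝ,
      fun s t => ?_⟩
    have e := ResidualTransferSSS.gradNormSq_sum_smul_eq_gram hg (fun i => s * a i + t * b i)
    beta_reduce at e
    rw [e, ResidualTransferSSS.gradNormSq_sum_smul_eq_gram hg a,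
      ResidualTransferSSS.gradNormSq_sum_smul_eq_gram hg b]
    simp only [Finset.mul_sum, mul_add, ← Finset.sum_add_distrib]
    refine Finset.sum_congr rfl fun i _ => Finset.sum_congr rfl fun i' _ => ?_
    ring
  have hnn : ∀ s t : ℝ, 0 ≤ s ^ 2 * Torus.gradNormSq (fun x => ∑ i, a i • g i x) + s * t * Z +
      t ^ 2 * Torus.gradNormSq (fun x => ∑ i, b i • g i x) := fun s t => by
    rw [← key]; exact Torus.gradNormSq_nonneg _
  rw [key]
  exact oddWeightedBudget_sqrt_quad_le hnn s t

/-! ### Minkowski in `L²(μ)` -/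

/-- **Minkowski in `L²(μ)` under a pointwise Minkowski bound.** If `F, A, C ≥ 0`, `A, C ∈ L¹(μ)`,
`K ≥ 0` and `√F ≤ √A + K√C` pointwise, then `(∫ F dμ)^{1/2} ≤ (∫ A dμ)^{1/2} + K (∫ C dμ)^{1/2}`
(`F ≤ A + 2K√A√C + K²C`, Cauchy–Schwarz `integral_mul_le_sqrt_mul_sqrt_of_memLp` of
`Literature/Analysis/FluidPDE/EnergyToolkit` on the cross term; no integrability of `F` is
needed, the Bochner integral of a non-integrable `F` being `0`). [folklore] -/
theorem oddWeightedBudget_sqrt_integral_le {α : Type*} [MeasurableSpace α] {μ : Measure α}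
    {F A C : α → ℝ} {K : ℝ} (hK : 0 ≤ K) (hF0 : ∀ x, 0 ≤ F x) (hA0 : ∀ x, 0 ≤ A x)
    (hC0 : ∀ x, 0 ≤ C x) (hA : Integrable A μ) (hC : Integrable C μ)
    (hle : ∀ x, Real.sqrt (F x) ≤ Real.sqrt (A x) + K * Real.sqrt (C x)) :
    Real.sqrt (∫ x, F x ∂μ) ≤ Real.sqrt (∫ x, A x ∂μ) + K * Real.sqrt (∫ x, C x ∂μ) := by
  -- `√A, √C ∈ L²(μ)`
  have hAm : AEStronglyMeasurable (fun x => Real.sqrt (A x)) μ :=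
    Real.continuous_sqrt.comp_aestronglyMeasurable hA.1
  have hCm : AEStronglyMeasurable (fun x => Real.sqrt (C x)) μ :=
    Real.continuous_sqrt.comp_aestronglyMeasurable hC.1
  have hA2 : Integrable (fun x => Real.sqrt (A x) ^ 2) μ :=
    hA.congr (ae_of_all _ fun x => (Real.sq_sqrt (hA0 x)).symm)
  have hC2 : Integrable (fun x => Real.sqrt (C x) ^ 2) μ :=
    hC.congr (ae_of_all _ fun x => (Real.sq_sqrt (hC0 x)).symm)
  have hAL : MemLp (fun x => Real.sqrt (A x)) 2 μ := (memLp_two_iff_integrable_sq hAm).2 hA2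
  have hCL : MemLp (fun x => Real.sqrt (C x)) 2 μ := (memLp_two_iff_integrable_sq hCm).2 hC2
  have hAC : Integrable (fun x => Real.sqrt (A x) * Real.sqrt (C x)) μ := hAL.integrable_mul hCL
  -- Cauchy–Schwarz on the cross term
  have hCS : ∫ x, Real.sqrt (A x) * Real.sqrt (C x) ∂μ ≤
      Real.sqrt (∫ x, A x ∂μ) * Real.sqrt (∫ x, C x ∂μ) := by
    have h := integral_mul_le_sqrt_mul_sqrt_of_memLp hAL hCL
    have eA : ∫ x, Real.sqrt (A x) ^ 2 ∂μ = ∫ x, A x ∂μ :=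
      integral_congr_ae (ae_of_all _ fun x => Real.sq_sqrt (hA0 x))
    have eC : ∫ x, Real.sqrt (C x) ^ 2 ∂μ = ∫ x, C x ∂μ :=
      integral_congr_ae (ae_of_all _ fun x => Real.sq_sqrt (hC0 x))
    rwa [eA, eC] at h
  -- the pointwise bound `F ≤ A + 2K√A√C + K²C`
  have hpt : ∀ x, F x ≤ A x + 2 * K * (Real.sqrt (A x) * Real.sqrt (C x)) + K ^ 2 * C x := by
    intro x
    have h1 : Real.sqrt (F x) ^ 2 ≤ (Real.sqrt (A x) + K * Real.sqrt (C x)) ^ 2 :=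
      pow_le_pow_left₀ (Real.sqrt_nonneg _) (hle x) 2
    rw [Real.sq_sqrt (hF0 x)] at h1
    have e : (Real.sqrt (A x) + K * Real.sqrt (C x)) ^ 2 =
        A x + 2 * K * (Real.sqrt (A x) * Real.sqrt (C x)) + K ^ 2 * C x := by
      rw [add_sq, mul_pow, Real.sq_sqrt (hA0 x), Real.sq_sqrt (hC0 x)]; ring
    linarith [h1, e]
  -- integrate
  have hI : ∫ x, F x ∂μ ≤ (∫ x, A x ∂μ) + 2 * K * (∫ x, Real.sqrt (A x) * Real.sqrt (C x) ∂μ) +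
      K ^ 2 * ∫ x, C x ∂μ := by
    have hg : Integrable
        (fun x => A x + 2 * K * (Real.sqrt (A x) * Real.sqrt (C x)) + K ^ 2 * C x) μ :=
      (hA.add (hAC.const_mul (2 * K))).add (hC.const_mul (K ^ 2))
    have h12 : Integrable (fun x => A x + 2 * K * (Real.sqrt (A x) * Real.sqrt (C x))) μ :=
      hA.add (hAC.const_mul (2 * K))
    have h2 : Integrable (fun x => 2 * K * (Real.sqrt (A x) * Real.sqrt (C x))) μ :=
      hAC.const_mul (2 * K)
    have h3 : Integrable (fun x => K ^ 2 * C x) μ := hC.const_mul (K ^ 2)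
    have h := integral_mono_of_nonneg (ae_of_all _ hF0) hg (ae_of_all _ hpt)
    rw [integral_add h12 h3, integral_add hA h2, integral_const_mul, integral_const_mul] at h
    exact h
  have hIA : 0 ≤ ∫ x, A x ∂μ := integral_nonneg fun x => hA0 x
  have hIC : 0 ≤ ∫ x, C x ∂μ := integral_nonneg fun x => hC0 x
  have hfin : ∫ x, F x ∂μ ≤ (Real.sqrt (∫ x, A x ∂μ) + K * Real.sqrt (∫ x, C x ∂μ)) ^ 2 := by
    have e : (Real.sqrt (∫ x, A x ∂μ) + K * Real.sqrt (∫ x, C x ∂μ)) ^ 2 =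
        (∫ x, A x ∂μ) + 2 * K * (Real.sqrt (∫ x, A x ∂μ) * Real.sqrt (∫ x, C x ∂μ)) +
          K ^ 2 * ∫ x, C x ∂μ := by
      rw [add_sq, mul_pow, Real.sq_sqrt hIA, Real.sq_sqrt hIC]; ring
    rw [e]
    have h2 := mul_le_mul_of_nonneg_left hCS (by positivity : (0 : ℝ) ≤ 2 * K)
    linarith
  calc Real.sqrt (∫ x, F x ∂μ)
      ≤ Real.sqrt ((Real.sqrt (∫ x, A x ∂μ) + K * Real.sqrt (∫ x, C x ∂μ)) ^ 2) :=
        Real.sqrt_le_sqrt hfin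
    _ = Real.sqrt (∫ x, A x ∂μ) + K * Real.sqrt (∫ x, C x ∂μ) := Real.sqrt_sq (by positivity)

/-! ### The odd-weighted budget inequality -/

/-- **S1 `stub_oddWeightedBudget`** (card: `OddWeightedBudget`). For a smooth force `f`, a
probability measure `μ` on `H` with defect constant `R ≥ 0`, a cylindrical test `Φ` with
`|φ| ≤ K` and a compactly supported `C¹` weight `ψ` of the same coordinates with `|ψ| ≤ 1`: the
defect clause at the PRODUCT test (profile `ψ·φ`, same fields; differential
`ψ(coords v) Φ'(v) + Φ(v) Ψ'(v)` by the Leibniz rule, `Ψ'(v) = ∑ᵢ ∂ᵢψ(coords v) gᵢ`), linearity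
of `w ↦ ⟨F₀(v), w⟩` in the smooth test field (`nsGeneratorPairing_sum_smul`) and Minkowski's
inequality in `L²(T³)` and in `L²(μ)` give
`|∫ (ψ ⟨F₀,Φ'⟩ + Φ ⟨F₀,Ψ'⟩) dμ| ≤ R (‖∇Φ'‖_{L²(μ;L²)} + K ‖∇Ψ'‖_{L²(μ;L²)})`. [folklore] -/
theorem stub_oddWeightedBudget (f : Vec3) (hf : Torus.IsSmooth f) (μ : Measure H3)
    (hprob : IsProbabilityMeasure μ) (R K : ℝ) (hR : 0 ≤ R) (hdef : DefectLE f μ R)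
    (Φ : Torus.CylindricalTest (Fin 3)) (ψ : EuclideanSpace ℝ (Fin Φ.m) → ℝ)
    (hψ : ContDiff ℝ 1 ψ) (hψc : HasCompactSupport ψ) (hψ1 : ∀ c, |ψ c| ≤ 1) (hφK : ∀ c, |Φ.φ c| ≤ K) :
    |∫ v, (ψ (Φ.coords v) * Torus.nsGeneratorPairing 0 f v (Φ.grad v) +
        Φ.eval v * Torus.nsGeneratorPairing 0 f v
          (fun x => ∑ i, (fderiv ℝ ψ (Φ.coords v) (EuclideanSpace.single i 1)) • Φ.g i x)) ∂μ| ≤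
      R * (Real.sqrt (∫ v, Torus.gradNormSq (Φ.grad v) ∂μ) +
        K * Real.sqrt (∫ v, Torus.gradNormSq
          (fun x => ∑ i, (fderiv ℝ ψ (Φ.coords v) (EuclideanSpace.single i 1)) • Φ.g i x) ∂μ)) := by
  have hK0 : 0 ≤ K := (abs_nonneg _).trans (hφK 0)
  have hf' : Integrable f volume := hf.integrable
  -- the product test `v ↦ ψ(coords v) Φ(v)` and the weight test `v ↦ ψ(coords v)`
  let P : Torus.CylindricalTest (Fin 3) :=
    { m := Φ.m, g := Φ.g, g_smooth := Φ.g_smooth, g_divFree := Φ.g_divFree,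
      g_zeroMean := Φ.g_zeroMean, φ := fun c => ψ c * Φ.φ c, φ_contDiff := hψ.mul Φ.φ_contDiff,
      φ_compact := Φ.φ_compact.mul_left }
  let Θ : Torus.CylindricalTest (Fin 3) :=
    { m := Φ.m, g := Φ.g, g_smooth := Φ.g_smooth, g_divFree := Φ.g_divFree,
      g_zeroMean := Φ.g_zeroMean, φ := ψ, φ_contDiff := hψ, φ_compact := hψc }
  -- Leibniz rule for the coefficients of `P'(v)`
  have hL : ∀ (v : H3) (i : Fin Φ.m), fderiv ℝ P.φ (P.coords v) (EuclideanSpace.single i 1) =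
      ψ (Φ.coords v) * fderiv ℝ Φ.φ (Φ.coords v) (EuclideanSpace.single i 1) +
        Φ.eval v * fderiv ℝ ψ (Φ.coords v) (EuclideanSpace.single i 1) := by
    intro v i
    show fderiv ℝ (fun c => ψ c * Φ.φ c) (Φ.coords v) (EuclideanSpace.single i 1) = _
    rw [fderiv_fun_mul (hψ.differentiable one_ne_zero).differentiableAt
      (Φ.φ_contDiff.differentiable one_ne_zero).differentiableAt]
    simp only [add_apply, smul_apply, smul_eq_mul]
    rfl
  have hPgrad : ∀ v : H3, P.grad v = fun x => ∑ i,
      (ψ (Φ.coords v) * fderiv ℝ Φ.φ (Φ.coords v) (EuclideanSpace.single i 1) +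
        Φ.eval v * fderiv ℝ ψ (Φ.coords v) (EuclideanSpace.single i 1)) • Φ.g i x := by
    intro v
    funext x
    show ∑ i, fderiv ℝ P.φ (P.coords v) (EuclideanSpace.single i 1) • Φ.g i x = _
    exact Finset.sum_congr rfl fun i _ => by rw [hL v i]
  -- (1) the odd-weighted integrand is the tested generator of the product test
  have hgen : ∀ v : H3, Torus.nsGeneratorPairing 0 f v (P.grad v) =
      ψ (Φ.coords v) * Torus.nsGeneratorPairing 0 f v (Φ.grad v) +
        Φ.eval v * Torus.nsGeneratorPairing 0 f v (Θ.grad v) := by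
    intro v
    rw [hPgrad v, Torus.nsGeneratorPairing_sum_smul 0 hf' v Finset.univ _ fun i _ => Φ.g_smooth i,
      Torus.nsGeneratorPairing_grad 0 hf' Φ v,
      show Torus.nsGeneratorPairing 0 f v (Θ.grad v) =
          ∑ i, fderiv ℝ ψ (Φ.coords v) (EuclideanSpace.single i 1) *
            Torus.nsGeneratorPairing 0 f v (Φ.g i) from Torus.nsGeneratorPairing_grad 0 hf' Θ v,
      Finset.mul_sum, Finset.mul_sum, ← Finset.sum_add_distrib]
    exact Finset.sum_congr rfl fun i _ => by ring
  have hI : ∫ v, (ψ (Φ.coords v) * Torus.nsGeneratorPairing 0 f v (Φ.grad v) +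
      Φ.eval v * Torus.nsGeneratorPairing 0 f v (Θ.grad v)) ∂μ =
        ∫ v, Torus.nsGeneratorPairing 0 f v (P.grad v) ∂μ :=
    integral_congr_ae (ae_of_all _ fun v => (hgen v).symm)
  -- (2) the defect clause at the product test
  obtain ⟨-, hdefP⟩ := hdef P
  -- (3) Minkowski in `L²(T³)`, pointwise in `v`, with `|ψ| ≤ 1`, `|φ| ≤ K`
  have hpt : ∀ v : H3, Real.sqrt (Torus.gradNormSq (P.grad v)) ≤
      Real.sqrt (Torus.gradNormSq (Φ.grad v)) + K * Real.sqrt (Torus.gradNormSq (Θ.grad v)) := by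
    intro v
    rw [hPgrad v]
    have h := oddWeightedBudget_sqrt_gradNormSq_le Φ.g_smooth
      (fun i => fderiv ℝ Φ.φ (Φ.coords v) (EuclideanSpace.single i 1))
      (fun i => fderiv ℝ ψ (Φ.coords v) (EuclideanSpace.single i 1)) (ψ (Φ.coords v)) (Φ.eval v)
    have h1 : |ψ (Φ.coords v)| * Real.sqrt (Torus.gradNormSq (Φ.grad v)) ≤
        Real.sqrt (Torus.gradNormSq (Φ.grad v)) := by
      have h' := mul_le_mul_of_nonneg_right (hψ1 (Φ.coords v))
        (Real.sqrt_nonneg (Torus.gradNormSq (Φ.grad v)))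
      rwa [one_mul] at h'
    have h2 : |Φ.eval v| * Real.sqrt (Torus.gradNormSq (Θ.grad v)) ≤
        K * Real.sqrt (Torus.gradNormSq (Θ.grad v)) :=
      mul_le_mul_of_nonneg_right (hφK (Φ.coords v)) (Real.sqrt_nonneg _)
    exact h.trans (add_le_add h1 h2)
  -- (4) the test enstrophies are `μ`-integrable (continuous and bounded on `H`)
  have hint : ∀ Ξ : Torus.CylindricalTest (Fin 3),
      Integrable (fun v : H3 => Torus.gradNormSq (Ξ.grad v)) μ := by
    intro Ξ
    obtain ⟨hc, C, hC⟩ := ResidualTransferSSS.stub_testEnstrophyTame Ξ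
    refine Integrable.mono' (integrable_const C) hc.aestronglyMeasurable (ae_of_all _ fun v => ?_)
    rw [Real.norm_of_nonneg (Torus.gradNormSq_nonneg _)]
    exact hC v
  -- (5) Minkowski in `L²(μ)` and the defect clause
  have hM := oddWeightedBudget_sqrt_integral_le (μ := μ) hK0
    (fun v => Torus.gradNormSq_nonneg (P.grad v)) (fun v => Torus.gradNormSq_nonneg (Φ.grad v))
    (fun v => Torus.gradNormSq_nonneg (Θ.grad v)) (hint Φ) (hint Θ) hpt
  have key : |∫ v, (ψ (Φ.coords v) * Torus.nsGeneratorPairing 0 f v (Φ.grad v) +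
      Φ.eval v * Torus.nsGeneratorPairing 0 f v (Θ.grad v)) ∂μ| ≤
        R * (Real.sqrt (∫ v, Torus.gradNormSq (Φ.grad v) ∂μ) +
          K * Real.sqrt (∫ v, Torus.gradNormSq (Θ.grad v) ∂μ)) := by
    rw [hI]
    exact hdefP.trans (mul_le_mul_of_nonneg_left hM hR)
  exact key

end Summit.AnomalousDissipation.AnomalousDissipation.Theorems.TameRoughRigidity.TameToRough

end
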